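import Mathlib
import HarnessLib
import Summits.ValiantsHypothesis.ValiantsHypothesis.Theses.MonotoneRestoration
import Literature.Computability.AlgebraicComplexity.ArithCircuit
import Literature.Computability.AlgebraicComplexity.ArithCircuitProofs
import Literature.Computability.AlgebraicComplexity.MonotoneStructure
import Literature.Computability.AlgebraicComplexity.PermanentIrreducible
import Literature.ModelTheory.FiniteModelTheory.CkEquiv
import Summits.ValiantsHypothesis.ValiantsHypothesis.Theorems.MonotoneRestorationMonotoneRestorationQPCosetCount
import Summits.ValiantsHypothesis.ValiantsHypothesis.Theorems.MonotoneRestorationMonotoneRestorationQPSymmetricLB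
import Summits.ValiantsHypothesis.ValiantsHypothesis.Theorems.MonotoneRestorationMonotoneRestorationQPSupportSymmetrisation
import Summits.ValiantsHypothesis.ValiantsHypothesis.Theorems.MonotoneRestorationMonotoneRestorationQPSparseRegime
import Summits.ValiantsHypothesis.ValiantsHypothesis.Theorems.MonotoneRestorationMonotoneRestorationQPBeta
import Literature.Computability.AlgebraicComplexity.SymmetricArithCircuit
import Literature.Computability.AlgebraicComplexity.DawarWilsenach2025Proofs
import Literature.GroupTheory.PermutationGroups.SmallIndexSubgroups
import Summits.ValiantsHypothesis.ValiantsHypothesis.Theorems.MonotoneRestorationQP.Negative.LoadBearing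
import Summits.ValiantsHypothesis.ValiantsHypothesis.Theorems.MonotoneRestorationMonotoneRestorationQPPermSupportCount
import Summits.ValiantsHypothesis.ValiantsHypothesis.Theorems.MonotoneRestorationMonotoneRestorationQPGammaSpine

/-! TTRL-lite variant V19990 of stmt-ValiantsHypothesis-15886 -/

-- `Summit.ValiantsHypothesis.ValiantsHypothesis.…` is the tree's mandated single-conjunct layout
-- (Sub = Summit), so the duplicated namespace component is intended.
set_option linter.dupNamespace false

namespace Summit.ValiantsHypothesis.ValiantsHypothesis.Theorems

open Summit.ValiantsHypothesis.ValiantsHypothesis.Theses.MonotoneRestoration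
open Literature.Computability.AlgebraicComplexity

/-- **No singleton child, per-monomial form** (TTRL-lite variant V19990 of
`stmt-ValiantsHypothesis-15886`): at a multiplication gate `g` guarded by `X` (`|X| < k`,
`|X| + 3 ≤ n`, `d + k ≤ n`) carrying a spine state, no child `h₀` has all its monomials living on
a single row `a ∉ X` while some monomial actually touches row `a` — this is
`mulGate_no_singleton_child` with the hypothesis "row shadow of `C.eval h₀` is `{a}`" spelled out
monomial by monomial. [folklore] -/
theorem stub_symmetricMonotone_var19990 :
    ∀ (n : ℕ) (G : Type) (C : LabelledArithCircuit NNReal (Fin n × Fin n) Unit G) (d k : ℕ)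
      (g h₀ : G) (X : Finset (Fin n)) (a : Fin n) (e : Fin n × Fin n →₀ ℕ),
      (C.eval (C.output ())).IsHomogeneous d → C.label g = CircuitLabel.mul → C.eval g ≠ 0 →
      X.card < k → X.card + 3 ≤ n → d + k ≤ n →
      (∀ ρ : Equiv.Perm (Fin n), (∀ x ∈ X, ρ x = x) → Equiv.Perm.sign ρ = 1 →
        ∃ π : Equiv.Perm G, C.IsAutomorphismExtending ρ π ∧ π g = g) →
      (∀ m' ∈ (C.eval g).support, m' + e ∈ (C.eval (C.output ())).support) →
      h₀ ∈ C.children g → a ∉ X →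
      (∀ m ∈ (C.eval h₀).support, ∀ i : Fin n, rowDegrees m i ≠ 0 → i = a) →
      (∃ m ∈ (C.eval h₀).support, rowDegrees m a ≠ 0) → False := by
  intro n G C d k g h₀ X a e hhom hg h0 hXk hX3 hdk haut he hh₀ haX hrows hex
  classical
  -- the row shadow of `C.eval h₀` is exactly `{a}`
  have hra : ((C.eval h₀).support.biUnion fun m => (rowDegrees m).support) = {a} := by
    ext i
    rw [mem_rowShadow_iff, Finset.mem_singleton]
    constructor
    · rintro ⟨m, hm, hi⟩
      exact hrows m hm i hi
    · rintro rfl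
      exact hex
  exact mulGate_no_singleton_child C hhom hg h0 X hXk hX3 hdk haut he hh₀ haX hra

end Summit.ValiantsHypothesis.ValiantsHypothesis.Theorems
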